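import Literature.NumberTheory.Automorphic.UnitaryGroupDirectSumCarriers
import Literature.NumberTheory.Automorphic.UnitaryGroupArithmeticLevels
import HarnessLib

/-!
# Direct sums of hermitian spaces on FINITE-adelic points: `U(W₁)(𝔸_{F,f}) × U(W₂)(𝔸_{F,f}) →* U(W₁ ⊕ W₂)(𝔸_{F,f})`

Topic `NumberTheory/Automorphic`; namespace `Literature.NumberTheory.Automorphic.UnitaryGroup`.  Definitions + theorems; NO named
fact, NO instance, NO `sorry`; net Literature debt 0.  The finite-adelic twin of §1 of `UnitaryGroupDirectSumCarriers`
(`adelicForm_finSum`, `adelic_finSum`, `adelicBlockDiag`, …, there on the FULL adelic points `UnitaryGroup.adelic`): for Gram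
matrices `J₁ ∈ M_{M₁}(E)`, `J₂ ∈ M_{M₂}(E)` over a CM extension `E/F` with involution `c`, the block-diagonal embedding
`(u₁, u₂) ↦ u₁ ⊕ᶠ u₂` of the finite-adelic unitary groups `UnitaryGroup.finAdelic F E c Mᵢ Jᵢ ≤ GL_{Mᵢ}(𝔸_E^∞)`
(`UnitaryGroupRestrictedProduct`) into `UnitaryGroup.finAdelic F E c (M₁ + M₂) (finSum M₁ M₂ J₁ J₂)` — the finite-adelic points of
the small member `U(W₁) × U(W₂) ⊂ U(W₁ ⊕ W₂)` of the see-saw ([Kudla1984] §1), equivalently of the sub-Shimura-datum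
`U(V⋆) × U(V⋆^⊥) ↪ U(V)` used by [Liu2021] Thm. 4.15 (step (S5)) — over the tree's generic `blockDiagFin` (any ring / involution,
`UnitaryGroupDirectSum`).  Cell `hodgecm-mathlib`, CENSUS k20 (A-plan1 g6): the map `φ_pin` of the v15 seesaw-source pin is
`finAdelicCongr … ∘ finAdelicBlockDiag …`.

## Contents
* `finiteAdelicForm_finSum` — `(J₁ ⊕ᶠ J₂) ⊗ 1 = (J₁ ⊗ 1) ⊕ᶠ (J₂ ⊗ 1)` over `𝔸_E^∞`; `finAdelic_finSum`.
* **`finAdelicBlockDiag F E c M₁ M₂ J₁ J₂ : finAdelic F E c M₁ J₁ × finAdelic F E c M₂ J₂ →* finAdelic F E c (M₁ + M₂) (finSum M₁ M₂ J₁ J₂)`**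
  with `coe_finAdelicBlockDiag` (rfl: `reindexGL finSumFinEquiv (blockDiagGL (u₁, u₂))`), `finAdelicBlockDiag_injective`,
  `continuous_finAdelicBlockDiag`, `commute_finAdelicBlockDiag_inl_inr`.
* `finAdelicBlockDiag_rationalToFinAdelic` — rational points go to rational points along the diagonal embeddings
  (`rationalToFinAdelic`, `rationalBlockDiag`).

## References
* [Kudla1984] S. Kudla, *Seesaw dual reductive pairs*, Progr. Math. 46 (1984), §1.
* [PlatonovRapinchuk1994] V. Platonov, A. Rapinchuk, *Algebraic Groups and Number Theory* (1994), §5.1 (adelic points of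
  algebraic groups; restricted products).
* [Liu2021] Y. Liu, Camb. J. Math. 9 (2021) = arXiv:2102.11518, proof of Thm. 4.15 l. 2203–2213 and of Thm. 4.18 l. 2258–2290.
-/

set_option autoImplicit false

noncomputable section

open scoped Matrix
open NumberField IsDedekindDomain

namespace Literature.NumberTheory.Automorphic.UnitaryGroup

variable (F E : Type) [Field F] [NumberField F] [Field E] [NumberField E] [Algebra F E]
variable (c : E ≃ₐ[F] E) (M₁ M₂ : ℕ) (J₁ : Matrix (Fin M₁) (Fin M₁) E) (J₂ : Matrix (Fin M₂) (Fin M₂) E)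

omit [NumberField F] in
/-- `(J₁ ⊕ᶠ J₂) ⊗ 1 = (J₁ ⊗ 1) ⊕ᶠ (J₂ ⊗ 1)` over `𝔸_E^∞`. [cite: Kudla1984, §1] -/
theorem finiteAdelicForm_finSum :
    finiteAdelicForm E (M₁ + M₂) (finSum M₁ M₂ J₁ J₂) =
      finSum M₁ M₂ (finiteAdelicForm E M₁ J₁) (finiteAdelicForm E M₂ J₂) :=
  finSum_map _ _ _

omit [NumberField F] in
/-- `U(J₁ ⊕ᶠ J₂)(𝔸_{F,f}) = U(c ⊗ 1, (J₁ ⊗ 1) ⊕ᶠ (J₂ ⊗ 1))` as subgroups of `GL_{M₁ + M₂}(𝔸_E^∞)`. [cite: PlatonovRapinchuk1994, §5.1] -/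
theorem finAdelic_finSum :
    finAdelic F E c (M₁ + M₂) (finSum M₁ M₂ J₁ J₂) =
      unitaryGroupOfForm (conjFiniteAdele F E c) (finSum M₁ M₂ (finiteAdelicForm E M₁ J₁) (finiteAdelicForm E M₂ J₂)) := by
  rw [finAdelic, finiteAdelicForm_finSum]

/-- **`U(J₁)(𝔸_{F,f}) × U(J₂)(𝔸_{F,f}) →* U(J₁ ⊕ᶠ J₂)(𝔸_{F,f})`, `(u₁, u₂) ↦ u₁ ⊕ᶠ u₂`** — the finite-adelic points of
`U(W₁) × U(W₂) ⊂ U(W₁ ⊕ W₂)` (small member of the see-saw; the sub-datum `U(V⋆) × U(V⋆^⊥) ↪ U(V)` of [Liu2021] Thm. 4.15 (S5)),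
the finite-adelic twin of `adelicBlockDiag`. [cite: Kudla1984, §1] [cite: Liu2021, proof of Thm. 4.15, l. 2203–2213] -/
def finAdelicBlockDiag :
    finAdelic F E c M₁ J₁ × finAdelic F E c M₂ J₂ →* finAdelic F E c (M₁ + M₂) (finSum M₁ M₂ J₁ J₂) :=
  (MulEquiv.subgroupCongr (finAdelic_finSum F E c M₁ M₂ J₁ J₂).symm).toMonoidHom.comp
    (blockDiagFin (conjFiniteAdele F E c) (finiteAdelicForm E M₁ J₁) (finiteAdelicForm E M₂ J₂))

omit [NumberField F] in
/-- underlying invertible matrix of `u₁ ⊕ᶠ u₂`: `reindex finSumFinEquiv finSumFinEquiv (diag(u₁, u₂))`. [cite: Kudla1984, §1] -/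
@[simp] theorem coe_finAdelicBlockDiag (u : finAdelic F E c M₁ J₁ × finAdelic F E c M₂ J₂) :
    ((finAdelicBlockDiag F E c M₁ M₂ J₁ J₂ u : finAdelic F E c (M₁ + M₂) (finSum M₁ M₂ J₁ J₂)) :
        GL (Fin (M₁ + M₂)) (FiniteAdeleRing (𝓞 E) E)) =
      reindexGL finSumFinEquiv (blockDiagGL ((u.1 : GL (Fin M₁) (FiniteAdeleRing (𝓞 E) E)),
        (u.2 : GL (Fin M₂) (FiniteAdeleRing (𝓞 E) E)))) :=
  rfl

omit [NumberField F] in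
/-- `finAdelicBlockDiag` is injective. [cite: Kudla1984, §1] -/
theorem finAdelicBlockDiag_injective : Function.Injective (finAdelicBlockDiag F E c M₁ M₂ J₁ J₂) :=
  fun _ _ huv => blockDiagFin_injective _ _ _
    ((MulEquiv.subgroupCongr (finAdelic_finSum F E c M₁ M₂ J₁ J₂).symm).injective huv)

omit [NumberField F] in
/-- **`finAdelicBlockDiag` is continuous** (for the subspace topologies from `GL_M(𝔸_E^∞)`). [cite: PlatonovRapinchuk1994, §5.1] -/
theorem continuous_finAdelicBlockDiag : Continuous (finAdelicBlockDiag F E c M₁ M₂ J₁ J₂) :=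
  Continuous.subtype_mk (continuous_subtype_val.comp (continuous_blockDiagFin _ _ _)) _

omit [NumberField F] in
/-- `u₁ ⊕ᶠ 1` and `1 ⊕ᶠ u₂` commute. [cite: Kudla1984, §1] -/
theorem commute_finAdelicBlockDiag_inl_inr (u₁ : finAdelic F E c M₁ J₁) (u₂ : finAdelic F E c M₂ J₂) :
    Commute (finAdelicBlockDiag F E c M₁ M₂ J₁ J₂ (u₁, 1)) (finAdelicBlockDiag F E c M₁ M₂ J₁ J₂ (1, u₂)) := by
  rw [Commute, SemiconjBy, ← map_mul, ← map_mul, Prod.mk_mul_mk, Prod.mk_mul_mk, one_mul, mul_one, one_mul, mul_one]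

omit [NumberField F] in
/-- **Rational points go to rational points**: `(γ₁)_f ⊕ᶠ (γ₂)_f = (γ₁ ⊕ᶠ γ₂)_f` along the diagonal embeddings
`U(Jᵢ)(F) →* U(Jᵢ)(𝔸_{F,f})` (`rationalToFinAdelic`) and `rationalBlockDiag`. [cite: PlatonovRapinchuk1994, §5.1] -/
theorem finAdelicBlockDiag_rationalToFinAdelic (γ₁ : rational F E c M₁ J₁) (γ₂ : rational F E c M₂ J₂) :
    finAdelicBlockDiag F E c M₁ M₂ J₁ J₂ (rationalToFinAdelic F E c M₁ J₁ γ₁, rationalToFinAdelic F E c M₂ J₂ γ₂) =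
      rationalToFinAdelic F E c (M₁ + M₂) (finSum M₁ M₂ J₁ J₂) (rationalBlockDiag F E c M₁ M₂ J₁ J₂ (γ₁, γ₂)) := by
  refine Subtype.ext ?_
  show reindexGL finSumFinEquiv (blockDiagGL
      (Matrix.GeneralLinearGroup.map (algebraMap E (FiniteAdeleRing (𝓞 E) E)) (γ₁ : GL (Fin M₁) E),
        Matrix.GeneralLinearGroup.map (algebraMap E (FiniteAdeleRing (𝓞 E) E)) (γ₂ : GL (Fin M₂) E))) =
    Matrix.GeneralLinearGroup.map (algebraMap E (FiniteAdeleRing (𝓞 E) E))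
      ((rationalBlockDiag F E c M₁ M₂ J₁ J₂ (γ₁, γ₂) : rational F E c (M₁ + M₂) (finSum M₁ M₂ J₁ J₂)) :
        GL (Fin (M₁ + M₂)) E)
  exact (map_coe_blockDiagFin (algebraMap E (FiniteAdeleRing (𝓞 E) E)) J₁ J₂ (γ₁, γ₂)).symm

omit [NumberField F] in
/-- `(γ₁)_f ⊕ᶠ (γ₂)_f ∈ range (rationalToFinAdelic)`. [cite: PlatonovRapinchuk1994, §5.1] -/
theorem finAdelicBlockDiag_rationalToFinAdelic_mem_range (γ₁ : rational F E c M₁ J₁) (γ₂ : rational F E c M₂ J₂) :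
    finAdelicBlockDiag F E c M₁ M₂ J₁ J₂ (rationalToFinAdelic F E c M₁ J₁ γ₁, rationalToFinAdelic F E c M₂ J₂ γ₂) ∈
      (rationalToFinAdelic F E c (M₁ + M₂) (finSum M₁ M₂ J₁ J₂)).range :=
  ⟨rationalBlockDiag F E c M₁ M₂ J₁ J₂ (γ₁, γ₂), (finAdelicBlockDiag_rationalToFinAdelic F E c M₁ M₂ J₁ J₂ γ₁ γ₂).symm⟩

end Literature.NumberTheory.Automorphic.UnitaryGroup

end
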